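import Literature.Probability.Distributions.GaussianHermiteChaos
import Mathlib.RingTheory.MvPolynomial.Basic
import Mathlib.RingTheory.MvPolynomial.Homogeneous
import Mathlib.Algebra.MvPolynomial.Monad
import HarnessLib

/-!
# Wick polynomial spaces do not depend on the orthonormal basis; intrinsic chaos components

For an orthonormal basis `b` of a finite-dimensional real inner product space `E` and `m : ℕ`, let
`𝒲_b(m) = {𝓗_b p : deg p ≤ m}` be the space of Wick (Hermite) evaluations of real polynomials of
total degree `≤ m` (`wickSpace b m`) and `𝒫_b(m) = {v ↦ p(⟪b₁,v⟫,…) : deg p ≤ m}` the space of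
ordinary polynomial functions of degree `≤ m` in the coordinates of `b` (`polySpace b m`). We prove

* `wickSpace_eq_polySpace` : `𝒲_b(m) = 𝒫_b(m)` — by a dimension count (`𝒲_b(m) ≤ 𝒫_b(m)`,
  `dim 𝒫_b(m) ≤ dim {deg ≤ m} = dim 𝒲_b(m)`, the last equality by injectivity of `𝓗_b`, i.e. by
  Hermite orthogonality), avoiding the triangularity of `xⁿ` in the `Heₖ`;
* `polySpace_eq_polySpace` : `𝒫_b(m) = 𝒫_{b'}(m)` (linear change of coordinates), hence
  `wickSpace_eq_wickSpace` : `𝒲_b(m) = 𝒲_{b'}(m)` (Janson 1997, Thm 3.21: `𝒫̄ₙ(H)` is intrinsic);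
* `hermiteEval_homogeneousComponent_eq` : **chaos components are intrinsic** — if
  `𝓗_b p = 𝓗_{b'} p'` then `𝓗_b (pₙ) = 𝓗_{b'} (p'ₙ)` for the homogeneous components of every
  degree `n` (Janson 1997, Thm 2.6/3.21: `H^{:n:} = 𝒫̄ₙ ⊖ 𝒫̄ₙ₋₁`).

## References
* S. Janson, *Gaussian Hilbert Spaces* (1997), Theorem 2.6, Definition 2.1–Remark 2.3,
  Theorem 3.21.
-/

open MeasureTheory ProbabilityTheory Finset Module
open scoped InnerProductSpace

namespace Literature.Probability.Distributions

open Literature.Algebra.Polynomial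

noncomputable section

variable {E : Type*} [NormedAddCommGroup E] [InnerProductSpace ℝ E]
variable {ι : Type*} [Fintype ι] [DecidableEq ι]

/-! ### The two evaluation maps as linear maps -/

/-- The Hermite (Wick) evaluation `𝓗_b` as a linear map `MvPolynomial ι ℝ →ₗ (E → ℝ)`. [folklore] -/
def hermiteEvalₗ (b : OrthonormalBasis ι ℝ E) : MvPolynomial ι ℝ →ₗ[ℝ] (E → ℝ) where
  toFun p := hermiteEval b p
  map_add' p q := funext fun v => hermiteEval_add b p q v
  map_smul' c p := funext fun v => by
    rw [RingHom.id_apply, Pi.smul_apply, smul_eq_mul, hermiteEval_smul]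

/-- `hermiteEvalₗ b p = 𝓗_b p`. [folklore] -/
@[simp]
theorem hermiteEvalₗ_apply (b : OrthonormalBasis ι ℝ E) (p : MvPolynomial ι ℝ) :
    hermiteEvalₗ b p = hermiteEval b p := rfl

omit [DecidableEq ι] in
/-- The ordinary evaluation of a polynomial at the coordinates `(⟪bᵢ, v⟫)ᵢ`, as a linear map. [folklore] -/
def coordEvalₗ (b : OrthonormalBasis ι ℝ E) : MvPolynomial ι ℝ →ₗ[ℝ] (E → ℝ) where
  toFun p := fun v => MvPolynomial.aeval (fun i => ⟪b i, v⟫_ℝ) p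
  map_add' p q := funext fun v => by simp
  map_smul' c p := funext fun v => by simp

omit [DecidableEq ι] in
/-- `coordEvalₗ b p v = p(⟪b₁, v⟫, …)`. [folklore] -/
@[simp]
theorem coordEvalₗ_apply (b : OrthonormalBasis ι ℝ E) (p : MvPolynomial ι ℝ) (v : E) :
    coordEvalₗ b p v = MvPolynomial.aeval (fun i => ⟪b i, v⟫_ℝ) p := rfl

/-- The space `𝒲_b(m)` of Wick evaluations of polynomials of total degree `≤ m`
(Janson's `𝒫̄ₘ(H)` realised through the basis `b`). [cite: Janson1997, Thm 3.21] -/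
def wickSpace (b : OrthonormalBasis ι ℝ E) (m : ℕ) : Submodule ℝ (E → ℝ) :=
  (MvPolynomial.restrictTotalDegree ι ℝ m).map (hermiteEvalₗ b)

omit [DecidableEq ι] in
/-- The space `𝒫_b(m)` of polynomial functions of degree `≤ m` in the coordinates of `b`
(Janson's `𝒫ₘ(H)`, Def. 2.1). [cite: Janson1997, Def. 2.1] -/
def polySpace (b : OrthonormalBasis ι ℝ E) (m : ℕ) : Submodule ℝ (E → ℝ) :=
  (MvPolynomial.restrictTotalDegree ι ℝ m).map (coordEvalₗ b)

/-! ### `𝒲_b(m) ≤ 𝒫_b(m)` -/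

/-- The polynomial `∏ᵢ He_{αᵢ}(Xᵢ)` whose ordinary evaluation is the Hermite function `H_α`. [folklore] -/
def hermitePoly (α : ι →₀ ℕ) : MvPolynomial ι ℝ :=
  ∏ i, Polynomial.aeval (MvPolynomial.X i : MvPolynomial ι ℝ) (hermiteR (α i))

omit [DecidableEq ι] in
/-- `H_α = coordEval (hermitePoly α)`. [folklore] -/
theorem coordEvalₗ_hermitePoly (b : OrthonormalBasis ι ℝ E) (α : ι →₀ ℕ) :
    coordEvalₗ b (hermitePoly α) = hermiteProd b α := by
  classical
  funext v
  simp only [coordEvalₗ_apply, hermitePoly, map_prod, hermiteProd]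
  refine Finset.prod_congr rfl fun i _ => ?_
  rw [← Polynomial.aeval_algHom_apply, MvPolynomial.aeval_X, Polynomial.coe_aeval_eq_eval]

omit [Fintype ι] [DecidableEq ι] in
/-- The total degree of the image of a univariate polynomial under `X ↦ Xᵢ` is at most its degree. [folklore] -/
theorem totalDegree_aeval_X_le (i : ι) (q : Polynomial ℝ) :
    (Polynomial.aeval (MvPolynomial.X i : MvPolynomial ι ℝ) q).totalDegree ≤ q.natDegree := by
  rw [Polynomial.aeval_eq_sum_range]
  refine (MvPolynomial.totalDegree_finsetSum _ _).trans (Finset.sup_le fun k hk => ?_)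
  refine (MvPolynomial.totalDegree_smul_le _ _).trans ?_
  refine (MvPolynomial.totalDegree_pow _ _).trans ?_
  rw [MvPolynomial.totalDegree_X]
  have := Finset.mem_range.1 hk
  simp only [mul_one]
  omega

omit [DecidableEq ι] in
/-- `deg (hermitePoly α) ≤ |α|`. [folklore] -/
theorem totalDegree_hermitePoly_le (α : ι →₀ ℕ) :
    (hermitePoly α : MvPolynomial ι ℝ).totalDegree ≤ ∑ i, α i := by
  unfold hermitePoly
  refine (MvPolynomial.totalDegree_finsetProd _ _).trans ?_
  exact Finset.sum_le_sum fun i _ => (totalDegree_aeval_X_le i _).trans (by simp)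

/-- `𝒲_b(m) ≤ 𝒫_b(m)`: a Wick polynomial of degree `≤ m` is an ordinary polynomial function of
degree `≤ m`. [folklore] -/
theorem wickSpace_le_polySpace (b : OrthonormalBasis ι ℝ E) (m : ℕ) :
    wickSpace b m ≤ polySpace b m := by
  rintro f ⟨p, hp, rfl⟩
  rw [SetLike.mem_coe, MvPolynomial.mem_restrictTotalDegree] at hp
  have hf : hermiteEvalₗ b p = ∑ α ∈ p.support, MvPolynomial.coeff α p • coordEvalₗ b (hermitePoly α) := by
    funext v
    simp only [hermiteEvalₗ_apply, Finset.sum_apply, Pi.smul_apply, smul_eq_mul,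
      coordEvalₗ_hermitePoly]
    rfl
  rw [hf]
  refine Submodule.sum_mem _ fun α hα => Submodule.smul_mem _ _ ⟨hermitePoly α, ?_, rfl⟩
  rw [SetLike.mem_coe, MvPolynomial.mem_restrictTotalDegree]
  refine (totalDegree_hermitePoly_le α).trans ?_
  rw [← Finsupp.sum_fintype α (fun _ n => n) fun _ => rfl]
  exact (MvPolynomial.le_totalDegree hα).trans hp

/-! ### Dimension count -/

section Gaussian

variable [FiniteDimensional ℝ E] [MeasurableSpace E] [BorelSpace E]

/-- `𝓗_b` is injective. [folklore] -/
theorem injective_hermiteEvalₗ (b : OrthonormalBasis ι ℝ E) : Function.Injective (hermiteEvalₗ b) := by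
  rw [← LinearMap.ker_eq_bot, Submodule.eq_bot_iff]
  intro p hp
  exact eq_zero_of_hermiteEval_eq_zero b (LinearMap.mem_ker.1 hp)

/-- **`𝒲_b(m) = 𝒫_b(m)`** (dimension count). [cite: Janson1997, Thm 3.21] -/
theorem wickSpace_eq_polySpace (b : OrthonormalBasis ι ℝ E) (m : ℕ) :
    wickSpace b m = polySpace b m := by
  haveI : Module.Finite ℝ (polySpace b m) := by unfold polySpace; infer_instance
  refine Submodule.eq_of_le_of_finrank_le (wickSpace_le_polySpace b m) ?_
  unfold wickSpace polySpace
  rw [← (Submodule.equivMapOfInjective _ (injective_hermiteEvalₗ b)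
    (MvPolynomial.restrictTotalDegree ι ℝ m)).finrank_eq]
  exact Submodule.finrank_map_le _ _

end Gaussian

/-! ### Change of orthonormal basis -/

/-- The linear substitution expressing the coordinates of `b` through those of `b'`:
`ℓᵢ = Σⱼ ⟪bᵢ, b'ⱼ⟫ Xⱼ`. [folklore] -/
def basisChange (b b' : OrthonormalBasis ι ℝ E) (i : ι) : MvPolynomial ι ℝ :=
  ∑ j, ⟪b i, b' j⟫_ℝ • MvPolynomial.X j

omit [DecidableEq ι] in
/-- `⟪bᵢ, v⟫ = Σⱼ ⟪bᵢ, b'ⱼ⟫ ⟪b'ⱼ, v⟫`. [folklore] -/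
theorem inner_eq_sum_inner_mul_inner (b b' : OrthonormalBasis ι ℝ E) (i : ι) (v : E) :
    ⟪b i, v⟫_ℝ = ∑ j, ⟪b i, b' j⟫_ℝ * ⟪b' j, v⟫_ℝ := by
  conv_lhs => rw [← b'.sum_repr' v]
  rw [inner_sum]
  refine Finset.sum_congr rfl fun j _ => ?_
  rw [inner_smul_right, mul_comm]

omit [DecidableEq ι] in
/-- Evaluating after the substitution: `coordEval_{b'} (bind₁ ℓ p) = coordEval_b p`. [folklore] -/
theorem coordEvalₗ_bind₁_basisChange (b b' : OrthonormalBasis ι ℝ E) (p : MvPolynomial ι ℝ) :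
    coordEvalₗ b' (MvPolynomial.bind₁ (basisChange b b') p) = coordEvalₗ b p := by
  funext v
  simp only [coordEvalₗ_apply, MvPolynomial.aeval_bind₁, basisChange, map_sum, map_smul,
    MvPolynomial.aeval_X, smul_eq_mul, ← inner_eq_sum_inner_mul_inner]

omit [DecidableEq ι] in
/-- The substitution polynomials are linear: `deg ℓᵢ ≤ 1`. [folklore] -/
theorem totalDegree_basisChange_le (b b' : OrthonormalBasis ι ℝ E) (i : ι) :
    (basisChange b b' i).totalDegree ≤ 1 := by
  unfold basisChange
  refine (MvPolynomial.totalDegree_finsetSum _ _).trans (Finset.sup_le fun j _ => ?_)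
  exact (MvPolynomial.totalDegree_smul_le _ _).trans (by rw [MvPolynomial.totalDegree_X])

omit [Fintype ι] [DecidableEq ι] in
/-- A linear substitution does not increase the total degree:
`deg (bind₁ ℓ p) ≤ deg p` when all `deg ℓᵢ ≤ 1`. [folklore] -/
theorem totalDegree_bind₁_le_of_linear {ℓ : ι → MvPolynomial ι ℝ} (hℓ : ∀ i, (ℓ i).totalDegree ≤ 1)
    (p : MvPolynomial ι ℝ) : (MvPolynomial.bind₁ ℓ p).totalDegree ≤ p.totalDegree := by
  classical
  rw [MvPolynomial.bind₁, MvPolynomial.aeval_def, MvPolynomial.eval₂_eq, MvPolynomial.totalDegree]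
  refine (MvPolynomial.totalDegree_finsetSum _ _).trans (Finset.sup_le fun α hα => ?_)
  refine (MvPolynomial.totalDegree_mul _ _).trans ?_
  rw [show (algebraMap ℝ (MvPolynomial ι ℝ)) (MvPolynomial.coeff α p) =
      MvPolynomial.C (MvPolynomial.coeff α p) from rfl, MvPolynomial.totalDegree_C, zero_add]
  refine (MvPolynomial.totalDegree_finsetProd _ _).trans ?_
  refine le_trans (Finset.sum_le_sum fun i _ => (MvPolynomial.totalDegree_pow _ _).trans
    (Nat.mul_le_mul_left _ (hℓ i))) ?_
  simp only [mul_one]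
  exact Finset.le_sup (f := fun s : ι →₀ ℕ => s.sum fun _ e => e) hα

omit [DecidableEq ι] in
/-- `𝒫_b(m) ≤ 𝒫_{b'}(m)`. [folklore] -/
theorem polySpace_le_polySpace (b b' : OrthonormalBasis ι ℝ E) (m : ℕ) :
    polySpace b m ≤ polySpace b' m := by
  rintro f ⟨p, hp, rfl⟩
  rw [SetLike.mem_coe, MvPolynomial.mem_restrictTotalDegree] at hp
  refine ⟨MvPolynomial.bind₁ (basisChange b b') p, ?_, coordEvalₗ_bind₁_basisChange b b' p⟩
  rw [SetLike.mem_coe, MvPolynomial.mem_restrictTotalDegree]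
  exact (totalDegree_bind₁_le_of_linear (totalDegree_basisChange_le b b') p).trans hp

omit [DecidableEq ι] in
/-- **`𝒫_b(m) = 𝒫_{b'}(m)`**: polynomial functions of degree `≤ m` form an intrinsic space
(Janson 1997, Def. 2.1 / Remark 2.3). [cite: Janson1997, Def. 2.1] -/
theorem polySpace_eq_polySpace (b b' : OrthonormalBasis ι ℝ E) (m : ℕ) :
    polySpace b m = polySpace b' m :=
  le_antisymm (polySpace_le_polySpace b b' m) (polySpace_le_polySpace b' b m)

section Gaussian

variable [FiniteDimensional ℝ E] [MeasurableSpace E] [BorelSpace E]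

/-- **`𝒲_b(m) = 𝒲_{b'}(m)`**: the space of Wick polynomials of degree `≤ m` does not depend on the
orthonormal basis (Janson 1997, Thm 3.21: each basis gives an orthogonal basis of `𝒫̄ₘ(H)`). [cite: Janson1997, Thm 3.21] -/
theorem wickSpace_eq_wickSpace (b b' : OrthonormalBasis ι ℝ E) (m : ℕ) :
    wickSpace b m = wickSpace b' m := by
  rw [wickSpace_eq_polySpace, wickSpace_eq_polySpace, polySpace_eq_polySpace]

/-- Every Wick polynomial w.r.t. `b` is a Wick polynomial of the same degree bound w.r.t. `b'`. [cite: Janson1997, Thm 3.21] -/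
theorem exists_hermiteEval_eq (b b' : OrthonormalBasis ι ℝ E) {p : MvPolynomial ι ℝ} {m : ℕ}
    (hp : p.totalDegree ≤ m) :
    ∃ p' : MvPolynomial ι ℝ, p'.totalDegree ≤ m ∧ hermiteEval b' p' = hermiteEval b p := by
  have h : hermiteEval b p ∈ wickSpace b' m := by
    rw [← wickSpace_eq_wickSpace b b']
    exact ⟨p, (MvPolynomial.mem_restrictTotalDegree _ _ _).2 hp, rfl⟩
  obtain ⟨p', hp', h'⟩ := h
  exact ⟨p', (MvPolynomial.mem_restrictTotalDegree _ _ _).1 hp', h'⟩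

/-! ### Chaos components are intrinsic -/

/-- High chaos is orthogonal to low-degree Wick polynomials: if every monomial of `q` has degree
`> m` and `deg r ≤ m` then `∫ 𝓗_b q · 𝓗_{b'} r dγ = 0` — for *any* second basis `b'`, since
`𝓗_{b'} r ∈ 𝒲_{b'}(m) = 𝒲_b(m)`. [cite: Janson1997, Thm 2.6] -/
theorem integral_hermiteEval_mul_eq_zero_of_degree (b b' : OrthonormalBasis ι ℝ E)
    {q r : MvPolynomial ι ℝ} {m : ℕ} (hq : ∀ α ∈ q.support, m < ∑ i, (α : ι →₀ ℕ) i)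
    (hr : r.totalDegree ≤ m) :
    ∫ v, hermiteEval b q v * hermiteEval b' r v ∂stdGaussian E = 0 := by
  obtain ⟨r', hr', h'⟩ := exists_hermiteEval_eq b' b hr
  rw [← h', integral_hermiteEval_mul_hermiteEval, fischerInner_eq_sum_of_subset
    (s := q.support ∪ r'.support) subset_rfl]
  refine Finset.sum_eq_zero fun α hα => ?_
  rcases Finset.mem_union.1 hα with h | h
  · have : MvPolynomial.coeff α r' = 0 := by
      by_contra hne
      have h1 := MvPolynomial.le_totalDegree (MvPolynomial.mem_support_iff.2 hne)
      rw [Finsupp.sum_fintype α (fun _ n => n) fun _ => rfl] at h1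
      have h2 := hq α h
      omega
    rw [this, mul_zero, mul_zero]
  · by_cases hαq : α ∈ q.support
    · have : MvPolynomial.coeff α r' = 0 := by
        by_contra hne
        have h1 := MvPolynomial.le_totalDegree (MvPolynomial.mem_support_iff.2 hne)
        rw [Finsupp.sum_fintype α (fun _ n => n) fun _ => rfl] at h1
        have h2 := hq α hαq
        omega
      rw [this, mul_zero, mul_zero]
    · rw [MvPolynomial.notMem_support_iff.1 hαq, zero_mul, mul_zero]

/-- The low-degree truncation `p_{≤m} = Σ_{n ≤ m} pₙ` of a polynomial. [folklore] -/
def truncDegree (m : ℕ) (p : MvPolynomial ι ℝ) : MvPolynomial ι ℝ :=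
  ∑ n ∈ Finset.range (m + 1), MvPolynomial.homogeneousComponent n p

omit [Fintype ι] [DecidableEq ι] in
/-- `deg p_{≤m} ≤ m`. [folklore] -/
theorem totalDegree_truncDegree_le (m : ℕ) (p : MvPolynomial ι ℝ) :
    (truncDegree m p).totalDegree ≤ m := by
  unfold truncDegree
  refine (MvPolynomial.totalDegree_finsetSum _ _).trans (Finset.sup_le fun n hn => ?_)
  have := (MvPolynomial.homogeneousComponent_isHomogeneous n p).totalDegree_le
  have hn' := Finset.mem_range.1 hn
  omega

omit [DecidableEq ι] in
/-- The monomials of `p - p_{≤m}` all have degree `> m`. [folklore] -/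
theorem lt_degree_of_mem_support_sub_truncDegree (m : ℕ) (p : MvPolynomial ι ℝ) :
    ∀ α ∈ (p - truncDegree m p).support, m < ∑ i, (α : ι →₀ ℕ) i := by
  intro α hα
  by_contra hle
  push Not at hle
  have hcoeff : MvPolynomial.coeff α (p - truncDegree m p) = 0 := by
    rw [MvPolynomial.coeff_sub, truncDegree, MvPolynomial.coeff_sum]
    simp_rw [MvPolynomial.coeff_homogeneousComponent, Finsupp.degree_eq_sum]
    rw [Finset.sum_ite_eq, if_pos (Finset.mem_range.2 (Nat.lt_succ_of_le hle)), sub_self]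
  exact (MvPolynomial.mem_support_iff.1 hα) hcoeff

/-- **Truncations are intrinsic**: if `𝓗_b p = 𝓗_{b'} p'` then `𝓗_b p_{≤m} = 𝓗_{b'} p'_{≤m}` for
every `m` (the orthogonal projection onto `𝒫̄ₘ` does not depend on the basis; Janson 1997 Thm 2.6).
[cite: Janson1997, Thm 2.6] -/
theorem hermiteEval_truncDegree_eq (b b' : OrthonormalBasis ι ℝ E) {p p' : MvPolynomial ι ℝ}
    (h : hermiteEval b p = hermiteEval b' p') (m : ℕ) :
    hermiteEval b (truncDegree m p) = hermiteEval b' (truncDegree m p') := by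
  -- write `𝓗_{b'} p'_{≤m} = 𝓗_b r` with `deg r ≤ m`
  obtain ⟨r, hr, hr'⟩ := exists_hermiteEval_eq b' b (totalDegree_truncDegree_le m p')
  rw [← hr']
  -- `s := p_{≤m} - r` has `𝓗_b s = (𝓗_{b'} p' - 𝓗_{b'} p'_{≤m}) - (𝓗_b p - 𝓗_b p_{≤m})` ⊥ `𝒲(m)`
  have hkey : ∫ v, hermiteEval b (truncDegree m p - r) v ^ 2 ∂stdGaussian E = 0 := by
    have hsplit : ∀ v, hermiteEval b (truncDegree m p - r) v =
        hermiteEval b' (p' - truncDegree m p') v - hermiteEval b (p - truncDegree m p) v := by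
      intro v
      have e1 : truncDegree m p - r = truncDegree m p + (-1 : ℝ) • r := by
        rw [neg_one_smul, sub_eq_add_neg]
      have e2 : p' - truncDegree m p' = p' + (-1 : ℝ) • truncDegree m p' := by
        rw [neg_one_smul, sub_eq_add_neg]
      have e3 : p - truncDegree m p = p + (-1 : ℝ) • truncDegree m p := by
        rw [neg_one_smul, sub_eq_add_neg]
      rw [e1, e2, e3, hermiteEval_add, hermiteEval_add, hermiteEval_add, hermiteEval_smul,
        hermiteEval_smul, hermiteEval_smul, ← congrFun h v, ← congrFun hr' v]
      ring
    have hsq : ∀ v, hermiteEval b (truncDegree m p - r) v ^ 2 =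
        hermiteEval b' (p' - truncDegree m p') v * hermiteEval b (truncDegree m p - r) v -
          hermiteEval b (p - truncDegree m p) v * hermiteEval b (truncDegree m p - r) v := by
      intro v; rw [sq, hsplit v]; ring
    simp_rw [hsq]
    have hdeg : (truncDegree m p - r).totalDegree ≤ m :=
      (MvPolynomial.totalDegree_sub _ _).trans (max_le (totalDegree_truncDegree_le m p) hr)
    rw [integral_sub, integral_hermiteEval_mul_eq_zero_of_degree b' b
        (lt_degree_of_mem_support_sub_truncDegree m p') hdeg,
      integral_hermiteEval_mul_eq_zero_of_degree b b
        (lt_degree_of_mem_support_sub_truncDegree m p) hdeg, sub_zero]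
    · obtain ⟨r₂, -, hr₂⟩ := exists_hermiteEval_eq b' b (le_refl (p' - truncDegree m p').totalDegree)
      simp_rw [← hr₂]
      exact integrable_hermiteEval_mul b _ _
    · exact integrable_hermiteEval_mul b _ _
  have hzero : truncDegree m p - r = 0 := by
    refine eq_zero_of_hermiteEval_ae_eq_zero b ?_
    have := (integral_eq_zero_iff_of_nonneg (fun v => sq_nonneg _)
      (integrable_hermiteEval_sq b _)).1 hkey
    filter_upwards [this] with v hv
    simpa using hv
  funext v
  have := congrFun (congrArg (hermiteEval b) (sub_eq_zero.1 hzero)) v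
  exact this

/-- **Chaos components are intrinsic** (Janson 1997, Thm 2.6 / Thm 3.21): if `𝓗_b p = 𝓗_{b'} p'`
then the Wick evaluations of the homogeneous components agree degree by degree. [cite: Janson1997, Thm 2.6] -/
theorem hermiteEval_homogeneousComponent_eq (b b' : OrthonormalBasis ι ℝ E)
    {p p' : MvPolynomial ι ℝ} (h : hermiteEval b p = hermiteEval b' p') (n : ℕ) :
    hermiteEval b (MvPolynomial.homogeneousComponent n p) =
      hermiteEval b' (MvPolynomial.homogeneousComponent n p') := by
  cases n with
  | zero =>
    have := hermiteEval_truncDegree_eq b b' h 0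
    simpa [truncDegree] using this
  | succ n =>
    have h1 := hermiteEval_truncDegree_eq b b' h (n + 1)
    have h0 := hermiteEval_truncDegree_eq b b' h n
    have e : ∀ q : MvPolynomial ι ℝ, MvPolynomial.homogeneousComponent (n + 1) q =
        truncDegree (n + 1) q + (-1 : ℝ) • truncDegree n q := by
      intro q
      rw [truncDegree, truncDegree, Finset.sum_range_succ, neg_one_smul]
      abel
    funext v
    rw [e, e, hermiteEval_add, hermiteEval_add, hermiteEval_smul, hermiteEval_smul,
      congrFun h1 v, congrFun h0 v]

end Gaussian

end

end Literature.Probability.Distributions
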